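import Mathlib
import HarnessLib
import Summits.ValiantsHypothesis.ValiantsHypothesis.Theorems.LacunarySymmetroidMatrixDescartesOsculationLawCommutingSheets

/-!
# ValiantsHypothesis / LacunarySymmetroid — crux `MatrixDescartes` (stmt-ValiantsHypothesis-18050, V1),
# line `Cruxes/MatrixDescartes/Lines/osculation_law.lean` («osculation-law»): the COMMUTING / DIAGONAL column,
# engine layer, part 1b — the GENERIC form of the sheet count (finiteness PROVED, not assumed) and the two
# exclusions as named lemmas (val-idea-crit-1 g2 verdict #60 (3)(i))

For a product of sheets `Φ = ∏_(i<r) (X₁ + ι(g_i))` (`supp g_i ⊆ E`) and its osculation-type set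
`O = {(t,b) : t > 0, b > 0, Φ = 0, H(Φ) = 0}` (line vocabulary unfolded as in part 1):

* (G1) every VISIBLE sheet (`g_i(t) < 0` for some `t > 0`) has a non-zero log-Wronskian `W(g_i) = g_i·θ²g_i − (θg_i)²`;
* (G2) two distinct indices with a visible sheet carry distinct polynomials `g_i ≠ g_j`.

`sheetProduct_subset_finset`: (G1) ∧ (G2) ⇒ `O` lies in an explicit finset of card
`≤ r·(C(|E|,2) − 1) + C(r,2)·(|E| − 1)`; hence `sheetProduct_finite_of_generic`, `sheetProduct_count_of_generic`
(the count of part 1 WITHOUT the finiteness hypothesis).  Conversely `logWronskian_ne_zero_of_finite`,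
`sub_ne_zero_of_finite` (the exclusions: finiteness forces (G1), (G2)) and `sheetProduct_finite_iff : O.Finite ↔ (G1) ∧ (G2)`.
Use: an explicit diagonal / commuting design gets finiteness AND the count by checking (G1)/(G2) on its fewnomials.

Honest framing: RESTRICTED-CLASS engine lemmas (commuting letters).  NOT the LAW `stub_osculationLaw`, not
`MatrixDescartes`, not Conjecture B; `VP ≠ VNP` is NOT proved.  No definitions, no named facts.
-/

-- `Summit.ValiantsHypothesis.ValiantsHypothesis.…` is the tree's mandated single-conjunct layout (Sub = Summit).
set_option linter.dupNamespace false

noncomputable section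

namespace Summit.ValiantsHypothesis.ValiantsHypothesis.Theorems.LacunarySymmetroidMatrixDescartes

namespace OsculationCommuting

open Polynomial
open scoped BigOperators

set_option maxHeartbeats 800000 in
/-- **The generic cover.**  Under (G1), (G2) the osculation-type set of a product of sheets lies in an explicit finite set:
the sheet points over the positive roots of the log-Wronskians `W(g_i)` and of the differences `g_i − g_j` (`i < j`). [folklore] -/
theorem sheetProduct_subset_finset {r : ℕ} (E : Finset ℕ) (g : Fin r → ℝ[X]) (hE : ∀ i, (g i).support ⊆ E)
    (Φ : MvPolynomial (Fin 2) ℝ)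
    (hΦ : Φ = ∏ i, (MvPolynomial.X 1 + Polynomial.aeval (MvPolynomial.X 0 : MvPolynomial (Fin 2) ℝ) (g i)))
    (hW : (∀ i (t : ℝ), 0 < t → (g i).eval t < 0 → g i * (X * derivative (X * derivative (g i))) - (X * derivative (g i)) ^ 2 ≠ 0))
    (hne : (∀ i j, i ≠ j → ∀ t : ℝ, 0 < t → (g i).eval t < 0 → g i - g j ≠ 0)) :
    ∃ F : Finset (Fin 2 → ℝ), F.card ≤ r * (E.card.choose 2 - 1) + r.choose 2 * (E.card - 1) ∧
      {p : Fin 2 → ℝ | 0 < p 0 ∧ 0 < p 1 ∧ MvPolynomial.eval p Φ = 0 ∧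
      MvPolynomial.eval p
        (MvPolynomial.X 0 * MvPolynomial.pderiv 0 (MvPolynomial.X 0 * MvPolynomial.pderiv 0 (Φ)) * (MvPolynomial.X 1 * MvPolynomial.pderiv 1 (Φ)) ^ 2
          - 2 * (MvPolynomial.X 0 * MvPolynomial.pderiv 0 (MvPolynomial.X 1 * MvPolynomial.pderiv 1 (Φ)))
            * (MvPolynomial.X 0 * MvPolynomial.pderiv 0 (Φ)) * (MvPolynomial.X 1 * MvPolynomial.pderiv 1 (Φ))
          + MvPolynomial.X 1 * MvPolynomial.pderiv 1 (MvPolynomial.X 1 * MvPolynomial.pderiv 1 (Φ)) * (MvPolynomial.X 0 * MvPolynomial.pderiv 0 (Φ)) ^ 2) = 0} ⊆ ↑F := by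
  classical
  set L : Fin r → MvPolynomial (Fin 2) ℝ := fun i => MvPolynomial.X 1 + Polynomial.aeval (MvPolynomial.X 0 : MvPolynomial (Fin 2) ℝ) (g i) with hL
  have hΦL : Φ = ∏ i, L i := hΦ
  have hevalL : ∀ i (p : Fin 2 → ℝ), MvPolynomial.eval p (L i) = p 1 + (g i).eval (p 0) := fun i p => eval_sheet (g i) p
  have hsplit : ∀ i, Φ = L i * ∏ j ∈ Finset.univ.erase i, L j := fun i => by
    rw [hΦL, Finset.mul_prod_erase _ _ (Finset.mem_univ i)]
  have hHΦ : ∀ i (p : Fin 2 → ℝ), p 1 + (g i).eval (p 0) = 0 →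
      MvPolynomial.eval p
        (MvPolynomial.X 0 * MvPolynomial.pderiv 0 (MvPolynomial.X 0 * MvPolynomial.pderiv 0 (Φ)) * (MvPolynomial.X 1 * MvPolynomial.pderiv 1 (Φ)) ^ 2
          - 2 * (MvPolynomial.X 0 * MvPolynomial.pderiv 0 (MvPolynomial.X 1 * MvPolynomial.pderiv 1 (Φ)))
            * (MvPolynomial.X 0 * MvPolynomial.pderiv 0 (Φ)) * (MvPolynomial.X 1 * MvPolynomial.pderiv 1 (Φ))
          + MvPolynomial.X 1 * MvPolynomial.pderiv 1 (MvPolynomial.X 1 * MvPolynomial.pderiv 1 (Φ)) * (MvPolynomial.X 0 * MvPolynomial.pderiv 0 (Φ)) ^ 2) =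
      MvPolynomial.eval p (∏ j ∈ Finset.univ.erase i, L j) ^ 3 * MvPolynomial.eval p
        (MvPolynomial.X 0 * MvPolynomial.pderiv 0 (MvPolynomial.X 0 * MvPolynomial.pderiv 0 (L i)) * (MvPolynomial.X 1 * MvPolynomial.pderiv 1 (L i)) ^ 2
          - 2 * (MvPolynomial.X 0 * MvPolynomial.pderiv 0 (MvPolynomial.X 1 * MvPolynomial.pderiv 1 (L i)))
            * (MvPolynomial.X 0 * MvPolynomial.pderiv 0 (L i)) * (MvPolynomial.X 1 * MvPolynomial.pderiv 1 (L i))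
          + MvPolynomial.X 1 * MvPolynomial.pderiv 1 (MvPolynomial.X 1 * MvPolynomial.pderiv 1 (L i)) * (MvPolynomial.X 0 * MvPolynomial.pderiv 0 (L i)) ^ 2) := by
    intro i p hp
    rw [hsplit i]
    exact OsculationGeneric.eval_logHessian_mul_of_eval_eq_zero (L i) _ p (by rw [hevalL]; exact hp)
  set f : Fin r → ℝ → (Fin 2 → ℝ) := fun i t => ![t, -(g i).eval t] with hf
  set A : Fin r → Finset (Fin 2 → ℝ) := fun i =>
    ((g i * (X * derivative (X * derivative (g i))) - (X * derivative (g i)) ^ 2).roots.toFinset.filter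
      (fun t => 0 < t)).image (f i) with hA
  set B : Fin r → Fin r → Finset (Fin 2 → ℝ) := fun i j =>
    ((g i - g j).roots.toFinset.filter (fun t => 0 < t)).image (f i) with hB
  refine ⟨Finset.univ.biUnion (fun i => A i ∪ (Finset.Ioi i).biUnion (fun j => B i j)), ?_, ?_⟩
  · -- the count
    have hAcard : ∀ i, (A i).card ≤ E.card.choose 2 - 1 := by
      intro i
      rw [hA]
      refine Finset.card_image_le.trans ?_
      by_cases h0 : g i * (X * derivative (X * derivative (g i))) - (X * derivative (g i)) ^ 2 = 0
      · rw [h0, roots_zero, Multiset.toFinset_zero, Finset.filter_empty, Finset.card_empty]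
        exact Nat.zero_le _
      · exact (card_posRoots_le h0).trans (Nat.sub_le_sub_right (card_support_logWronskian_le (hE i)) 1)
    have hBcard : ∀ i j, (B i j).card ≤ E.card - 1 := by
      intro i j
      rw [hB]
      refine Finset.card_image_le.trans ?_
      by_cases h0 : g i - g j = 0
      · rw [h0, roots_zero, Multiset.toFinset_zero, Finset.filter_empty, Finset.card_empty]
        exact Nat.zero_le _
      · exact (card_posRoots_le h0).trans (Nat.sub_le_sub_right (card_support_sub_le (hE i) (hE j)) 1)
    refine Finset.card_biUnion_le.trans ?_
    calc ∑ i, (A i ∪ (Finset.Ioi i).biUnion (fun j => B i j)).card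
        ≤ ∑ i : Fin r, ((E.card.choose 2 - 1) + (Finset.Ioi i).card * (E.card - 1)) := by
          refine Finset.sum_le_sum fun i _ => (Finset.card_union_le _ _).trans (Nat.add_le_add (hAcard i) ?_)
          refine Finset.card_biUnion_le.trans ?_
          rw [← smul_eq_mul, ← Finset.sum_const]
          exact Finset.sum_le_sum fun j _ => hBcard i j
      _ = r * (E.card.choose 2 - 1) + r.choose 2 * (E.card - 1) := by
          rw [Finset.sum_add_distrib, Finset.sum_const, Finset.card_univ, Fintype.card_fin, smul_eq_mul,
            ← Finset.sum_mul, sum_card_Ioi_fin]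
  · -- the cover
    intro p hp
    obtain ⟨ht, hb, hΦ0, hH0⟩ := hp
    have hex : ∃ i, p 1 + (g i).eval (p 0) = 0 := by
      rw [hΦL, MvPolynomial.eval_prod, Finset.prod_eq_zero_iff] at hΦ0
      obtain ⟨i, -, hi⟩ := hΦ0
      exact ⟨i, by rw [← hevalL]; exact hi⟩
    set S : Finset (Fin r) := Finset.univ.filter (fun i => p 1 + (g i).eval (p 0) = 0) with hS
    have hSne : S.Nonempty := by
      obtain ⟨i, hi⟩ := hex
      exact ⟨i, Finset.mem_filter.2 ⟨Finset.mem_univ i, hi⟩⟩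
    set i := S.min' hSne with hi
    have hiS : p 1 + (g i).eval (p 0) = 0 := (Finset.mem_filter.1 (Finset.min'_mem S hSne)).2
    have hvis : (g i).eval (p 0) < 0 := by linarith
    have hpf : p = f i (p 0) := by
      rw [hf]; ext k; fin_cases k
      · rfl
      · simp only [Fin.mk_one, Matrix.cons_val_one, Matrix.cons_val_zero]; linarith
    rw [Finset.mem_coe, Finset.mem_biUnion]
    refine ⟨i, Finset.mem_univ i, ?_⟩
    rw [Finset.mem_union]
    by_cases hex2 : ∃ j, j ≠ i ∧ p 1 + (g j).eval (p 0) = 0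
    · obtain ⟨j, hji, hj⟩ := hex2
      have hjS : j ∈ S := Finset.mem_filter.2 ⟨Finset.mem_univ j, hj⟩
      have hij : i < j := lt_of_le_of_ne (Finset.min'_le S j hjS) (Ne.symm hji)
      refine Or.inr (Finset.mem_biUnion.2 ⟨j, Finset.mem_Ioi.2 hij, ?_⟩)
      rw [hB, Finset.mem_image]
      refine ⟨p 0, Finset.mem_filter.2 ⟨?_, ht⟩, hpf.symm⟩
      rw [Multiset.mem_toFinset, mem_roots (hne i j (ne_of_lt hij) (p 0) ht hvis), IsRoot.def, eval_sub]
      linarith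
    · push Not at hex2
      have hM : MvPolynomial.eval p (∏ j ∈ Finset.univ.erase i, L j) ≠ 0 := by
        rw [MvPolynomial.eval_prod, Finset.prod_ne_zero_iff]
        intro j hj
        rw [hevalL]
        exact hex2 j (Finset.mem_erase.1 hj).1
      have hHi : MvPolynomial.eval p
          (MvPolynomial.X 0 * MvPolynomial.pderiv 0 (MvPolynomial.X 0 * MvPolynomial.pderiv 0 (L i)) * (MvPolynomial.X 1 * MvPolynomial.pderiv 1 (L i)) ^ 2
          - 2 * (MvPolynomial.X 0 * MvPolynomial.pderiv 0 (MvPolynomial.X 1 * MvPolynomial.pderiv 1 (L i)))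
            * (MvPolynomial.X 0 * MvPolynomial.pderiv 0 (L i)) * (MvPolynomial.X 1 * MvPolynomial.pderiv 1 (L i))
          + MvPolynomial.X 1 * MvPolynomial.pderiv 1 (MvPolynomial.X 1 * MvPolynomial.pderiv 1 (L i)) * (MvPolynomial.X 0 * MvPolynomial.pderiv 0 (L i)) ^ 2) = 0 := by
        have h := hH0
        rw [hHΦ i p hiS] at h
        exact (mul_eq_zero.1 h).resolve_left (pow_ne_zero 3 hM)
      refine Or.inl ?_
      rw [hA, Finset.mem_image]
      refine ⟨p 0, Finset.mem_filter.2 ⟨?_, ht⟩, hpf.symm⟩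
      rw [Multiset.mem_toFinset, mem_roots (hW i (p 0) ht hvis), IsRoot.def]
      exact logWronskian_root_of_sheet (g i) p hb.ne' hiS hHi

/-- **Finiteness from genericity**: (G1) ∧ (G2) ⇒ the osculation-type set is finite. [folklore] -/
theorem sheetProduct_finite_of_generic {r : ℕ} (E : Finset ℕ) (g : Fin r → ℝ[X]) (hE : ∀ i, (g i).support ⊆ E)
    (Φ : MvPolynomial (Fin 2) ℝ)
    (hΦ : Φ = ∏ i, (MvPolynomial.X 1 + Polynomial.aeval (MvPolynomial.X 0 : MvPolynomial (Fin 2) ℝ) (g i)))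
    (hW : (∀ i (t : ℝ), 0 < t → (g i).eval t < 0 → g i * (X * derivative (X * derivative (g i))) - (X * derivative (g i)) ^ 2 ≠ 0))
    (hne : (∀ i j, i ≠ j → ∀ t : ℝ, 0 < t → (g i).eval t < 0 → g i - g j ≠ 0)) :
    {p : Fin 2 → ℝ | 0 < p 0 ∧ 0 < p 1 ∧ MvPolynomial.eval p Φ = 0 ∧
      MvPolynomial.eval p
        (MvPolynomial.X 0 * MvPolynomial.pderiv 0 (MvPolynomial.X 0 * MvPolynomial.pderiv 0 (Φ)) * (MvPolynomial.X 1 * MvPolynomial.pderiv 1 (Φ)) ^ 2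
          - 2 * (MvPolynomial.X 0 * MvPolynomial.pderiv 0 (MvPolynomial.X 1 * MvPolynomial.pderiv 1 (Φ)))
            * (MvPolynomial.X 0 * MvPolynomial.pderiv 0 (Φ)) * (MvPolynomial.X 1 * MvPolynomial.pderiv 1 (Φ))
          + MvPolynomial.X 1 * MvPolynomial.pderiv 1 (MvPolynomial.X 1 * MvPolynomial.pderiv 1 (Φ)) * (MvPolynomial.X 0 * MvPolynomial.pderiv 0 (Φ)) ^ 2) = 0}.Finite := by
  obtain ⟨F, -, hF⟩ := sheetProduct_subset_finset E g hE Φ hΦ hW hne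
  exact F.finite_toSet.subset hF

/-- **The count from genericity** (no finiteness hypothesis). [folklore] -/
theorem sheetProduct_count_of_generic {r : ℕ} (E : Finset ℕ) (g : Fin r → ℝ[X]) (hE : ∀ i, (g i).support ⊆ E)
    (Φ : MvPolynomial (Fin 2) ℝ)
    (hΦ : Φ = ∏ i, (MvPolynomial.X 1 + Polynomial.aeval (MvPolynomial.X 0 : MvPolynomial (Fin 2) ℝ) (g i)))
    (hW : (∀ i (t : ℝ), 0 < t → (g i).eval t < 0 → g i * (X * derivative (X * derivative (g i))) - (X * derivative (g i)) ^ 2 ≠ 0))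
    (hne : (∀ i j, i ≠ j → ∀ t : ℝ, 0 < t → (g i).eval t < 0 → g i - g j ≠ 0)) :
    {p : Fin 2 → ℝ | 0 < p 0 ∧ 0 < p 1 ∧ MvPolynomial.eval p Φ = 0 ∧
      MvPolynomial.eval p
        (MvPolynomial.X 0 * MvPolynomial.pderiv 0 (MvPolynomial.X 0 * MvPolynomial.pderiv 0 (Φ)) * (MvPolynomial.X 1 * MvPolynomial.pderiv 1 (Φ)) ^ 2
          - 2 * (MvPolynomial.X 0 * MvPolynomial.pderiv 0 (MvPolynomial.X 1 * MvPolynomial.pderiv 1 (Φ)))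
            * (MvPolynomial.X 0 * MvPolynomial.pderiv 0 (Φ)) * (MvPolynomial.X 1 * MvPolynomial.pderiv 1 (Φ))
          + MvPolynomial.X 1 * MvPolynomial.pderiv 1 (MvPolynomial.X 1 * MvPolynomial.pderiv 1 (Φ)) * (MvPolynomial.X 0 * MvPolynomial.pderiv 0 (Φ)) ^ 2) = 0}.ncard ≤
      r * (E.card.choose 2 - 1) + r.choose 2 * (E.card - 1) := by
  obtain ⟨F, hcard, hF⟩ := sheetProduct_subset_finset E g hE Φ hΦ hW hne
  calc _ ≤ (↑F : Set (Fin 2 → ℝ)).ncard := Set.ncard_le_ncard hF F.finite_toSet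
    _ = F.card := Set.ncard_coe_finset F
    _ ≤ _ := hcard

/-! ### The two exclusions (finiteness forces genericity) -/

/-- **Exclusion 1.**  If the osculation-type set of a product of sheets is finite, every visible sheet has a non-zero
log-Wronskian (else the whole visible arc of the sheet osculates). [folklore] -/
theorem logWronskian_ne_zero_of_finite {r : ℕ} (g : Fin r → ℝ[X]) (Φ : MvPolynomial (Fin 2) ℝ)
    (hΦ : Φ = ∏ i, (MvPolynomial.X 1 + Polynomial.aeval (MvPolynomial.X 0 : MvPolynomial (Fin 2) ℝ) (g i)))
    (hfin : {p : Fin 2 → ℝ | 0 < p 0 ∧ 0 < p 1 ∧ MvPolynomial.eval p Φ = 0 ∧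
      MvPolynomial.eval p
        (MvPolynomial.X 0 * MvPolynomial.pderiv 0 (MvPolynomial.X 0 * MvPolynomial.pderiv 0 (Φ)) * (MvPolynomial.X 1 * MvPolynomial.pderiv 1 (Φ)) ^ 2
          - 2 * (MvPolynomial.X 0 * MvPolynomial.pderiv 0 (MvPolynomial.X 1 * MvPolynomial.pderiv 1 (Φ)))
            * (MvPolynomial.X 0 * MvPolynomial.pderiv 0 (Φ)) * (MvPolynomial.X 1 * MvPolynomial.pderiv 1 (Φ))
          + MvPolynomial.X 1 * MvPolynomial.pderiv 1 (MvPolynomial.X 1 * MvPolynomial.pderiv 1 (Φ)) * (MvPolynomial.X 0 * MvPolynomial.pderiv 0 (Φ)) ^ 2) = 0}.Finite) :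
    (∀ i (t : ℝ), 0 < t → (g i).eval t < 0 → g i * (X * derivative (X * derivative (g i))) - (X * derivative (g i)) ^ 2 ≠ 0) := by
  classical
  intro i t₀ ht₀ hgt hW0
  set L : Fin r → MvPolynomial (Fin 2) ℝ := fun i => MvPolynomial.X 1 + Polynomial.aeval (MvPolynomial.X 0 : MvPolynomial (Fin 2) ℝ) (g i) with hL
  have hΦL : Φ = ∏ i, L i := hΦ
  have hevalL : ∀ i (p : Fin 2 → ℝ), MvPolynomial.eval p (L i) = p 1 + (g i).eval (p 0) := fun i p => eval_sheet (g i) p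
  refine hfin.not_infinite (infinite_of_sheet_subset (g i) t₀ ht₀ hgt fun t ht hg => ?_)
  have hp : (![t, -(g i).eval t] : Fin 2 → ℝ) 1 + (g i).eval ((![t, -(g i).eval t] : Fin 2 → ℝ) 0) = 0 := by simp
  refine ⟨by simpa using ht, by simpa using hg, ?_, ?_⟩
  · rw [hΦL, MvPolynomial.eval_prod]
    exact Finset.prod_eq_zero (Finset.mem_univ i) (by rw [hevalL]; exact hp)
  · rw [hΦL, ← Finset.mul_prod_erase _ _ (Finset.mem_univ i),
      OsculationGeneric.eval_logHessian_mul_of_eval_eq_zero (L i) _ _ (by rw [hevalL]; exact hp),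
      eval_logHessian_sheet_eq_zero_of_logWronskian (g i) _ hp (by rw [hW0, eval_zero]), mul_zero]

/-- **Exclusion 2.**  If the osculation-type set of a product of sheets is finite, two distinct indices with a visible
sheet carry distinct polynomials (else the sheet is a square factor and its visible arc is singular). [folklore] -/
theorem sub_ne_zero_of_finite {r : ℕ} (g : Fin r → ℝ[X]) (Φ : MvPolynomial (Fin 2) ℝ)
    (hΦ : Φ = ∏ i, (MvPolynomial.X 1 + Polynomial.aeval (MvPolynomial.X 0 : MvPolynomial (Fin 2) ℝ) (g i)))
    (hfin : {p : Fin 2 → ℝ | 0 < p 0 ∧ 0 < p 1 ∧ MvPolynomial.eval p Φ = 0 ∧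
      MvPolynomial.eval p
        (MvPolynomial.X 0 * MvPolynomial.pderiv 0 (MvPolynomial.X 0 * MvPolynomial.pderiv 0 (Φ)) * (MvPolynomial.X 1 * MvPolynomial.pderiv 1 (Φ)) ^ 2
          - 2 * (MvPolynomial.X 0 * MvPolynomial.pderiv 0 (MvPolynomial.X 1 * MvPolynomial.pderiv 1 (Φ)))
            * (MvPolynomial.X 0 * MvPolynomial.pderiv 0 (Φ)) * (MvPolynomial.X 1 * MvPolynomial.pderiv 1 (Φ))
          + MvPolynomial.X 1 * MvPolynomial.pderiv 1 (MvPolynomial.X 1 * MvPolynomial.pderiv 1 (Φ)) * (MvPolynomial.X 0 * MvPolynomial.pderiv 0 (Φ)) ^ 2) = 0}.Finite) :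
    (∀ i j, i ≠ j → ∀ t : ℝ, 0 < t → (g i).eval t < 0 → g i - g j ≠ 0) := by
  classical
  intro i j hij t₀ ht₀ hgt h0
  have hgg : g j = g i := (sub_eq_zero.1 h0).symm
  set L : Fin r → MvPolynomial (Fin 2) ℝ := fun i => MvPolynomial.X 1 + Polynomial.aeval (MvPolynomial.X 0 : MvPolynomial (Fin 2) ℝ) (g i) with hL
  have hΦL : Φ = ∏ i, L i := hΦ
  have hevalL : ∀ i (p : Fin 2 → ℝ), MvPolynomial.eval p (L i) = p 1 + (g i).eval (p 0) := fun i p => eval_sheet (g i) p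
  refine hfin.not_infinite (infinite_of_sheet_subset (g i) t₀ ht₀ hgt fun t ht hg => ?_)
  have hp : (![t, -(g i).eval t] : Fin 2 → ℝ) 1 + (g i).eval ((![t, -(g i).eval t] : Fin 2 → ℝ) 0) = 0 := by simp
  refine ⟨by simpa using ht, by simpa using hg, ?_, ?_⟩
  · rw [hΦL, MvPolynomial.eval_prod]
    exact Finset.prod_eq_zero (Finset.mem_univ i) (by rw [hevalL]; exact hp)
  · rw [hΦL, ← Finset.mul_prod_erase _ _ (Finset.mem_univ i),
      OsculationGeneric.eval_logHessian_mul_of_eval_eq_zero (L i) _ _ (by rw [hevalL]; exact hp), MvPolynomial.eval_prod,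
      Finset.prod_eq_zero (Finset.mem_erase.2 ⟨hij.symm, Finset.mem_univ j⟩) (by rw [hevalL, hgg]; exact hp)]
    ring

/-- **Finiteness ⇔ genericity** for the osculation-type set of a product of sheets. [folklore] -/
theorem sheetProduct_finite_iff {r : ℕ} (E : Finset ℕ) (g : Fin r → ℝ[X]) (hE : ∀ i, (g i).support ⊆ E)
    (Φ : MvPolynomial (Fin 2) ℝ)
    (hΦ : Φ = ∏ i, (MvPolynomial.X 1 + Polynomial.aeval (MvPolynomial.X 0 : MvPolynomial (Fin 2) ℝ) (g i))) :
    {p : Fin 2 → ℝ | 0 < p 0 ∧ 0 < p 1 ∧ MvPolynomial.eval p Φ = 0 ∧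
      MvPolynomial.eval p
        (MvPolynomial.X 0 * MvPolynomial.pderiv 0 (MvPolynomial.X 0 * MvPolynomial.pderiv 0 (Φ)) * (MvPolynomial.X 1 * MvPolynomial.pderiv 1 (Φ)) ^ 2
          - 2 * (MvPolynomial.X 0 * MvPolynomial.pderiv 0 (MvPolynomial.X 1 * MvPolynomial.pderiv 1 (Φ)))
            * (MvPolynomial.X 0 * MvPolynomial.pderiv 0 (Φ)) * (MvPolynomial.X 1 * MvPolynomial.pderiv 1 (Φ))
          + MvPolynomial.X 1 * MvPolynomial.pderiv 1 (MvPolynomial.X 1 * MvPolynomial.pderiv 1 (Φ)) * (MvPolynomial.X 0 * MvPolynomial.pderiv 0 (Φ)) ^ 2) = 0}.Finite ↔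
      (∀ i (t : ℝ), 0 < t → (g i).eval t < 0 → g i * (X * derivative (X * derivative (g i))) - (X * derivative (g i)) ^ 2 ≠ 0) ∧
      (∀ i j, i ≠ j → ∀ t : ℝ, 0 < t → (g i).eval t < 0 → g i - g j ≠ 0) :=
  ⟨fun h => ⟨logWronskian_ne_zero_of_finite g Φ hΦ h, sub_ne_zero_of_finite g Φ hΦ h⟩,
    fun h => sheetProduct_finite_of_generic E g hE Φ hΦ h.1 h.2⟩

end OsculationCommuting

end Summit.ValiantsHypothesis.ValiantsHypothesis.Theorems.LacunarySymmetroidMatrixDescartes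

end
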